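import Mathlib

/-!
# `RestartPrinciple` (stmt-AtomisticToContinuum-12503): the profile-first `∃ σ₀` defect of restart data

Third schema non-entailment of the crux chain (after `anchored_schema_false` and `prefixMfirst_schema_false`,
`Theorems/RestartPrinciple/Negative/RestartSchema.lean`, p99454), recorded by lead c12 of line `IdeatorFourSketch` as the
abstract reason why the line's residue — statements about RESTART data `(Φ_r)_* LG_τ`, `τ ∈ [0, t]` (the flow-box decoupling
stmt-15329, the mean collision flux `CF` and the cubic moments `C3` "along the Euler activity family") — is fed neither by the
conjunct `G = _root_.HydrodynamicLimit` / stmt-11927 nor by the time-0-data items stmt-13734 / stmt-9235, although each of those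
speaks about every continuous positive initial profile: all of them choose `σ₀` AFTER the initial profile
(`∀ profile, ∃ σ₀ > 0, ∀ σ < σ₀, …`), whereas a restart profile `(a τ, u τ, θ τ)` exists only once `σ` (and the classical solution it
indexes) is fixed. Abstractly: a `G`-shaped statement `∀ p, ∃ σ₀ > 0, ∀ σ ∈ (0, σ₀), L σ p` does not entail its restart form
`∀ p₀, ∃ σ₀ > 0, ∀ σ ∈ (0, σ₀), ∀ τ ∈ [0, 1], L σ (evolve σ τ p₀)` for a `σ`-dependent evolution with `evolve σ 0 p₀ = p₀` — the
witness below has `L σ p` true for every profile at small `σ`, and the evolved profile merely drifts at speed `σ⁻¹` (as the `C³`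
size of a restart profile measured in units natural to `σ` may). This is the restart obstruction of the crux in its third guise:
time-0 theorems do not restart unless `σ₀` is uniform over the propagated class of profiles, which is an extra theorem, not
bookkeeping. Pure logic over `ℝ`; no definitions.
-/

namespace Summit.AtomisticToContinuum.HydrodynamicLimit.Theorems.RestartPrinciple.RestartDataSchema

/-- PROFILE-FIRST DEFECT. A `G`-shaped statement (`σ₀` chosen per initial profile) about time-0 data does not entail the same
statement along a `σ`-dependent family of restart profiles anchored at the initial one, uniformly on a compact range of restart
times. Witness: profiles `ℝ`, `L σ p := σ * (1 + |p|) < 1` (true for `σ < (1 + |p|)⁻¹`), `evolve σ τ p := p + τ / σ`; at `p₀ = 0`,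
`τ = 1` the evolved instance reads `σ + 1 < 1`. -/
theorem profileFirst_schema_false :
    ¬ ∀ (L : ℝ → ℝ → Prop) (evolve : ℝ → ℝ → ℝ → ℝ),
        (∀ p : ℝ, ∃ σ₀ : ℝ, 0 < σ₀ ∧ ∀ σ : ℝ, 0 < σ → σ < σ₀ → L σ p) →
        (∀ σ p₀ : ℝ, evolve σ 0 p₀ = p₀) →
        ∀ p₀ : ℝ, ∃ σ₀ : ℝ, 0 < σ₀ ∧ ∀ σ : ℝ, 0 < σ → σ < σ₀ →
          ∀ τ ∈ Set.Icc (0 : ℝ) 1, L σ (evolve σ τ p₀) := by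
  intro h
  have hL : ∀ p : ℝ, ∃ σ₀ : ℝ, 0 < σ₀ ∧ ∀ σ : ℝ, 0 < σ → σ < σ₀ → σ * (1 + |p|) < 1 := by
    intro p
    refine ⟨(1 + |p|)⁻¹, by positivity, fun σ hσ hσlt => ?_⟩
    have hp : 0 < 1 + |p| := by positivity
    calc σ * (1 + |p|) < (1 + |p|)⁻¹ * (1 + |p|) := mul_lt_mul_of_pos_right hσlt hp
      _ = 1 := inv_mul_cancel₀ hp.ne'
  have hE : ∀ σ p₀ : ℝ, p₀ + 0 / σ = p₀ := fun σ p₀ => by simp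
  obtain ⟨σ₀, hσ₀, hσ⟩ := h (fun σ p => σ * (1 + |p|) < 1) (fun σ τ p => p + τ / σ) hL hE 0
  have hhalf : 0 < σ₀ / 2 := half_pos hσ₀
  have hbad := hσ (σ₀ / 2) hhalf (half_lt_self hσ₀) 1 ⟨zero_le_one, le_rfl⟩
  have hval : (0 : ℝ) + 1 / (σ₀ / 2) = 2 / σ₀ := by ring
  rw [hval, abs_of_pos (by positivity)] at hbad
  have hexp : σ₀ / 2 * (1 + 2 / σ₀) = σ₀ / 2 + 1 := by field_simp
  rw [hexp] at hbad
  linarith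

/-- The same defect with the evolution suppressed from the hypotheses' side: even a statement holding for EVERY profile at EVERY
`σ ∈ (0, 1)` off a `σ`-dependent exceptional profile set does not restart — stated positively, what DOES restart is a statement whose
`σ₀` is uniform over the whole propagated class (`hunif`); then the restart form is immediate. Recorded to mark exactly which extra
uniformity a time-0 theorem must carry before it can feed a restart-data stub. -/
theorem restart_of_uniform_threshold (L : ℝ → ℝ → Prop) (evolve : ℝ → ℝ → ℝ → ℝ) (K : Set ℝ)
    (hunif : ∃ σ₀ : ℝ, 0 < σ₀ ∧ ∀ σ : ℝ, 0 < σ → σ < σ₀ → ∀ p ∈ K, L σ p)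
    (hstay : ∀ σ : ℝ, 0 < σ → ∀ p₀ ∈ K, ∀ τ ∈ Set.Icc (0 : ℝ) 1, evolve σ τ p₀ ∈ K) :
    ∀ p₀ ∈ K, ∃ σ₀ : ℝ, 0 < σ₀ ∧ ∀ σ : ℝ, 0 < σ → σ < σ₀ →
      ∀ τ ∈ Set.Icc (0 : ℝ) 1, L σ (evolve σ τ p₀) := by
  obtain ⟨σ₀, hσ₀, h⟩ := hunif
  intro p₀ hp₀
  exact ⟨σ₀, hσ₀, fun σ hσ hσlt τ hτ => h σ hσ hσlt _ (hstay σ hσ p₀ hp₀ τ hτ)⟩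

end Summit.AtomisticToContinuum.HydrodynamicLimit.Theorems.RestartPrinciple.RestartDataSchema
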